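import Literature.InformationTheory.QuantumCodes.CSSPhenomenologicalConverse
import Literature.InformationTheory.QuantumCodes.DepolarizingCSSDecoding
import Literature.InformationTheory.QuantumCodes.TwoRateThreshold
import HarnessLib

/-!
# The PHENOMENOLOGICAL DEPOLARIZING model of a CSS code (three rates: qubits depolarized at rate `p` per round,
# `X`-check outcomes wrong at rate `q_X`, `Z`-check outcomes wrong at rate `q_Z`), decoded SECTOR-WISE in space-time:
# `max(P^Z, P^X) ≤ P_fail ≤ P^Z + P^X` with `P^Z = P^{Z,ph}(2p/3, q_X)`, `P^X = P^{X,ph}(2p/3, q_Z)`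

Topic `Literature/InformationTheory/QuantumCodes` (venture QEC, LADDER-QEC rung Q5, PARTITION row 09 "noise models: i.i.d.
depolarising; phenomenological"; qec-type-09 gen 5, item 09.PHDEPOL). The tree has the two ingredients separately:
`DepolarizingCSSDecoding.lean` (qec-type-09 gen 3: CODE-CAPACITY depolarizing noise decoded sector-wise; the two marginals of
the i.i.d. depolarizing law are independent flips of rate `2p/3`, `sum_depolarizingProb_zBit_mem` / `_xBit_mem`) and
`CSSPhenomenologicalThreshold.lean` (qec-lit-2: the `T`-round memory experiment of ONE sector with independent qubit faults
at rate `p` and measurement faults at rate `q`, `CSSPhenom.phenomFailureProb H T SX D p q`). This file COMBINES them: the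
space-time (repeated-measurement) model of Dennis–Kitaev–Landahl–Preskill §4.1–4.2 — whose own qubit channel is the
INDEPENDENT `X`/`Z` model at equal rate `p` (arXiv:quant-ph/0110143 chunk p0012 L5–17; `Y` at rate `p²`), with measurement
faults "We will denote by $q$ the probability that the measured syndrome bit is faulty at a given site or plaquette"
(p0012 L18) and separate recovery of the two error types (paraphrase of p0012 L16: DKLP note that `X`/`Z` correlations
"would not cause much trouble, since we have separate procedures for recovery from the $X$ errors and the $Z$ errors") —
is run here with the DEPOLARIZING qubit channel instead: the tree's `depolarizingLaw` / `depolarizingProb` of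
`PauliNoise.lean` / `DepolarizingCSSDecoding.lean` (each of `X, Y, Z` with probability `p/3`; the convention of
Aliferis–Gottesman–Preskill §8.2, arXiv:quant-ph/0504218 chunk p0026 L11: "a Pauli operator, chosen equiprobably from among
$\{X,Y,Z \}$"; the depolarizing channel is one of the three error models of Dumer–Kovalev–Pryadko, arXiv:1412.6172 chunk
p0003 L59–60). So: in each of `T` rounds every qubit suffers a fresh Pauli fault drawn from the depolarizing law of rate
`p`, then all `X`-checks (`H^X`, detecting the phase-flip part) and all `Z`-checks (`H^Z`, detecting the bit-flip part)
are measured, each recorded bit being wrong independently with probability `q_X` resp. `q_Z`; a perfect closing round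
ends the window (as in `CSSPhenom`); the two sectors are decoded separately AND blind to the `X`/`Z` correlation carried
by `Y` faults. A space-time decoder `DZ` of the `X`-check record estimates the phase-flip
history, a space-time decoder `DX` of the `Z`-check record the bit-flip history; the memory experiment FAILS iff one of the
two projected residuals is not a stabilizer part. Definitions REAL (finite sums), theorems PROVED, no named fact:

* `CSSPhenom.zHistory E mX` / `CSSPhenom.xHistory E mZ` — the two one-sector histories (`CSSPhenom.History`) seen by the two
  decoders: phase-flip parts `zBit ∘ E` of the Pauli fault history with the `X`-check measurement faults, resp. bit-flip
  parts with the `Z`-check measurement faults.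
* `CSSPhenom.depolPhenomWeight T p qX qZ E mX mZ = depolarizingProb p E · w_{qX}(mX) · w_{qZ}(mZ)` — the three-rate law
  (product of the i.i.d. depolarizing law on the `|Q|·T` qubit fault locations and independent flips on the two kinds of
  measurement locations); a probability law (`sum_depolPhenomWeight`).
* `CSSCode.depolPhenomFailureProb C T DZ DX p qX qZ` — the failure probability of sector-wise space-time decoding.
* MARGINALS (`sum_depolPhenomWeight_zFails`, `sum_depolPhenomWeight_xFails`): the law of `zHistory` is EXACTLY the two-rate
  phenomenological law `(2p/3, q_X)` of `CSSPhenom`, that of `xHistory` the law `(2p/3, q_Z)`: the mass of the event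
  "`DZ` fails" is `CSSPhenom.phenomFailureProb C.HX T (rs H^Z) DZ (2p/3) qX`, and symmetrically.
* SANDWICH (`CSSCode.zPhenom_le_depolPhenomFailureProb`, `CSSCode.xPhenom_le_depolPhenomFailureProb`,
  `CSSCode.depolPhenomFailureProb_le`): `max(P^Z, P^X) ≤ P_fail ≤ P^Z + P^X`. Consequently the threshold REGION of the
  three-rate model under sector-wise space-time decoding is exactly the set of `(p, q_X, q_Z)` with `(2p/3, q_X)` in the
  `Z`-sector two-rate region and `(2p/3, q_Z)` in the `X`-sector one (family forms `CSSCode.depolPhenom_belowThreshold_iff`,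
  `CSSCode.depolPhenom_belowThreshold_of_box`): every certified two-rate box `p₀` of the two sectors gives the certified
  three-rate box `p < (3/2)p₀`, `q_X, q_Z < p₀` (toric code: `p < .0168`, `q < .0112`, Summits side).

HONEST FRAMING: the `3/2` is the elementary marginal factor (`P(fault ∈ {Y, Z}) = 2p/3` in the `p/3`-per-Pauli convention)
for decoders that ignore the `Y`-correlations; a LOWER bound on the region for that decoder class (and, by the left
inequality, the EXACT region for it), not a statement about correlation-aware decoding and not a Monte Carlo number; the
three-rate model and its theorems are OURS (DKLP analyse the independent `X`/`Z` channel; no printed statement is being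
re-asserted); syndrome-extraction CIRCUIT noise (hook errors, AGP06 exRecs) is NOT this model.

## References

* [DennisEtAl2002] E. Dennis, A. Kitaev, A. Landahl, J. Preskill, *Topological quantum memory*, J. Math. Phys. 43 (2002)
  4452–4505, arXiv:quant-ph/0110143, §4.1 (chunk p0012 L5–18: independent `X`/`Z` qubit errors at rate `p`; measurement
  faults at rate `q`; separate recovery procedures for `X` and `Z` errors), §4.2 (repeated measurement, the error
  history), §5.2 (Prob_fail), §5.3 eqs. (threshold_iso), (threshold_iso_num).
* [DumerKovalevPryadko2015] I. Dumer, A. A. Kovalev, L. P. Pryadko, PRL 115 (2015) 050502, arXiv:1412.6172, chunk p0003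
  L59–60 (the depolarizing channel among the three error models), Thm 3 (phenomenological model), eq.
  (succesful-decoding-depolarizing) (both residuals must be trivial).
* [AliferisGottesmanPreskill2006] P. Aliferis, D. Gottesman, J. Preskill, QIC 6 (2006) 97, arXiv:quant-ph/0504218, §8.2
  (chunk p0026 L11: depolarizing faults = a Pauli operator chosen equiprobably from `{X, Y, Z}`, i.e. `p/3` each).
-/

noncomputable section

namespace Literature.InformationTheory.QuantumCodes

open Finset Matrix Filter Topology Literature.Computability.QuantumComplexity

namespace CSSPhenom

variable {RX RZ Q : Type*} {T : ℕ}

/-! ### The two one-sector histories of a Pauli fault history -/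

/-- The **`Z`-sector history** seen by the decoder of the `X`-check record: the phase-flip parts (`zBit`, letters `Y, Z`)
of the Pauli faults on the qubit locations, the `X`-check measurement faults on the measurement locations.
[cite: DennisEtAl2002, §4.1–4.2 (chunk p0012: qubit errors and faulty site-syndrome bits, one error history per error type)] -/
def zHistory (E : Q × Fin T → Pauli) (mX : RX × Fin T → ZMod 2) : History RX Q T :=
  Sum.elim (fun vt => zBit (E vt)) mX

/-- The **`X`-sector history** seen by the decoder of the `Z`-check record: bit-flip parts (`xBit`, letters `X, Y`) and
`Z`-check measurement faults. [cite: DennisEtAl2002, §4.1–4.2 (chunk p0012: the second error type and the faulty plaquette-syndrome bits)] -/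
def xHistory (E : Q × Fin T → Pauli) (mZ : RZ × Fin T → ZMod 2) : History RZ Q T :=
  Sum.elim (fun vt => xBit (E vt)) mZ

/-- `zHistory E mX = Sum.elim (zBit ∘ E) mX`. [cite: DennisEtAl2002, §4.2] -/
theorem zHistory_eq (E : Q × Fin T → Pauli) (mX : RX × Fin T → ZMod 2) :
    zHistory E mX = Sum.elim (fun vt => zBit (E vt)) mX := rfl

/-- `xHistory E mZ = Sum.elim (xBit ∘ E) mZ`. [cite: DennisEtAl2002, §4.2] -/
theorem xHistory_eq (E : Q × Fin T → Pauli) (mZ : RZ × Fin T → ZMod 2) :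
    xHistory E mZ = Sum.elim (fun vt => xBit (E vt)) mZ := rfl

/-! ### The three-rate law -/

variable [Fintype Q] [Fintype RX] [Fintype RZ] [DecidableEq Q] [DecidableEq RX] [DecidableEq RZ]

/-- The **phenomenological depolarizing law** with `T` rounds: i.i.d. depolarizing faults of rate `p` on the `|Q|·T` qubit
fault locations, independent wrong outcomes at rate `qX` on the `X`-check measurement locations and `qZ` on the `Z`-check
ones — the mass of the fault configuration `(E, mX, mZ)`. Definition.
[cite: AliferisGottesmanPreskill2006, §8.2 (arXiv:quant-ph/0504218 chunk p0026 L11: X, Y, Z equiprobable)]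
[cite: DennisEtAl2002, §4.1 (chunk p0012 L18: q = probability that a measured syndrome bit is faulty)] -/
def depolPhenomWeight (T : ℕ) (p qX qZ : ℝ) (E : Q × Fin T → Pauli) (mX : RX × Fin T → ZMod 2)
    (mZ : RZ × Fin T → ZMod 2) : ℝ :=
  depolarizingProb p E * (bernoulliWeight qX (supp mX) * bernoulliWeight qZ (supp mZ))

omit [Fintype Q] [Fintype RX] [Fintype RZ] [DecidableEq Q] [DecidableEq RX] [DecidableEq RZ] in
/-- The i.i.d. depolarizing law is a probability law: `Σ_E depolarizingProb p E = 1`.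
[cite: AliferisGottesmanPreskill2006, §8.2 (arXiv:quant-ph/0504218 chunk p0026 L11: the depolarizing channel, X, Y, Z equiprobable)] -/
theorem sum_depolarizingProb {X : Type*} [Fintype X] [DecidableEq X] (p : ℝ) :
    ∑ E : X → Pauli, depolarizingProb p E = 1 := by
  have h := sum_depolarizingProb_zBit_mem (Q := X) p univ
  rw [Finset.filter_true_of_mem (fun E _ => mem_univ _), sum_bernoulliWeight_supp] at h
  exact h

/-- **The three-rate law is a probability law.** [cite: DennisEtAl2002, §4.4 eq. (prob_E)] -/
theorem sum_depolPhenomWeight (T : ℕ) (p qX qZ : ℝ) :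
    ∑ E : Q × Fin T → Pauli, ∑ mX : RX × Fin T → ZMod 2, ∑ mZ : RZ × Fin T → ZMod 2,
      depolPhenomWeight T p qX qZ E mX mZ = 1 := by
  simp only [depolPhenomWeight, ← Finset.mul_sum, sum_bernoulliWeight_supp, mul_one]
  exact sum_depolarizingProb p

omit [DecidableEq Q] [DecidableEq RX] [DecidableEq RZ] in
/-- The three-rate law is non-negative for rates in `[0, 1]`. [cite: DennisEtAl2002, §4.4 eq. (prob_E)] -/
theorem depolPhenomWeight_nonneg {p qX qZ : ℝ} (hp0 : 0 ≤ p) (hp1 : p ≤ 1) (hqX0 : 0 ≤ qX) (hqX1 : qX ≤ 1)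
    (hqZ0 : 0 ≤ qZ) (hqZ1 : qZ ≤ 1) (E : Q × Fin T → Pauli) (mX : RX × Fin T → ZMod 2)
    (mZ : RZ × Fin T → ZMod 2) : 0 ≤ depolPhenomWeight T p qX qZ E mX mZ :=
  mul_nonneg (depolarizingProb_nonneg hp0 hp1 E)
    (mul_nonneg (bernoulliWeight_nonneg hqX0 hqX1 _) (bernoulliWeight_nonneg hqZ0 hqZ1 _))

/-! ### The two-rate phenomenological law of a one-sector history factorises -/

omit [Fintype Q] [Fintype RX] [Fintype RZ] [DecidableEq Q] [DecidableEq RX] [DecidableEq RZ] in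
/-- The independent weight of a support, as a pointwise product. [cite: DennisEtAl2002, §4.4 eq. (prob_E)] -/
theorem indepWeight_supp_eq_prod {X : Type*} [Fintype X] [DecidableEq X] (r : X → ℝ) (x : X → ZMod 2) :
    indepWeight r (supp x) = ∏ i, if x i = 0 then 1 - r i else r i := by
  have hsupp : univ.filter (fun i => ¬ x i = 0) = supp x := by
    ext i; simp [supp]
  have hcompl : univ.filter (fun i => x i = 0) = univ \ supp x := by
    ext i; simp [supp]
  have h1 : (∏ i ∈ univ.filter (fun i => x i = 0), if x i = 0 then 1 - r i else r i) =
      ∏ i ∈ univ \ supp x, (1 - r i) := by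
    rw [hcompl]
    exact Finset.prod_congr rfl fun i hi => by
      rw [if_pos]
      simpa [supp] using hi
  have h2 : (∏ i ∈ univ.filter (fun i => ¬ x i = 0), if x i = 0 then 1 - r i else r i) =
      ∏ i ∈ supp x, r i := by
    rw [hsupp]
    exact Finset.prod_congr rfl fun i hi => by
      rw [if_neg]
      simpa [supp] using hi
  rw [indepWeight, ← Finset.prod_filter_mul_prod_filter_not univ (fun i => x i = 0), h1, h2, mul_comm]

omit [Fintype RZ] [DecidableEq RZ] in
/-- **The two-rate law of a one-sector history factorises**: the phenomenological weight `(p, q)` of the history with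
qubit part `z` and measurement part `m` is `w_p(z) · w_q(m)` (independent flips of rate `p` on the qubit locations times
independent flips of rate `q` on the measurement locations). [cite: DennisEtAl2002, §5.1 eq. (HV_prob)] -/
theorem phenomenologicalWeight_supp_sum_elim (p q : ℝ) (z : Q × Fin T → ZMod 2) (m : RX × Fin T → ZMod 2) :
    phenomenologicalWeight T p q (supp (Sum.elim z m : History RX Q T)) =
      bernoulliWeight p (supp z) * bernoulliWeight q (supp m) := by
  rw [phenomenologicalWeight, indepWeight_supp_eq_prod, Fintype.prod_sum_type, ← prod_ite_eq_bernoulliWeight,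
    ← prod_ite_eq_bernoulliWeight]
  simp [phenomRate]

omit [Fintype RZ] [DecidableEq RZ] in
open Classical in
/-- **The one-sector two-rate failure probability, summed qubit part by measurement part**:
`P^{ph}(p, q) = Σ_m w_q(m) · Σ_{z : D fails on (z, m)} w_p(z)`. [cite: DennisEtAl2002, §5.2 (Prob_fail) with §5.1 eq. (HV_prob)] -/
theorem phenomFailureProb_eq_sum_meas (H : Matrix RX Q (ZMod 2)) (T : ℕ) (SX : Set (Q → ZMod 2))
    (D : STDecoder RX Q T) (p q : ℝ) :
    phenomFailureProb H T SX D p q =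
      ∑ m : RX × Fin T → ZMod 2, bernoulliWeight q (supp m) *
        ∑ z ∈ univ.filter (fun z : Q × Fin T → ZMod 2 =>
            ¬ D.Corrects (stSyn H T) (stTrivial SX T) (Sum.elim z m)),
          bernoulliWeight p (supp z) := by
  unfold phenomFailureProb
  rw [Finset.sum_filter]
  rw [Fintype.sum_equiv (Equiv.sumArrowEquivProdArrow (Q × Fin T) (RX × Fin T) (ZMod 2))
    (fun E : History RX Q T =>
      if ¬ D.Corrects (stSyn H T) (stTrivial SX T) E then phenomenologicalWeight T p q (supp E) else 0)
    (fun zm : (Q × Fin T → ZMod 2) × (RX × Fin T → ZMod 2) =>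
      if ¬ D.Corrects (stSyn H T) (stTrivial SX T) (Sum.elim zm.1 zm.2) then
        bernoulliWeight p (supp zm.1) * bernoulliWeight q (supp zm.2) else 0)
    (fun E => by
      change _ = (if ¬ D.Corrects (stSyn H T) (stTrivial SX T) (Sum.elim (E ∘ Sum.inl) (E ∘ Sum.inr)) then
        bernoulliWeight p (supp (E ∘ Sum.inl)) * bernoulliWeight q (supp (E ∘ Sum.inr)) else 0)
      rw [← phenomenologicalWeight_supp_sum_elim p q (E ∘ Sum.inl) (E ∘ Sum.inr), Sum.elim_comp_inl_inr])]
  rw [Fintype.sum_prod_type, Finset.sum_comm]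
  refine Finset.sum_congr rfl fun m _ => ?_
  rw [Finset.mul_sum, Finset.sum_filter]
  refine Finset.sum_congr rfl fun z _ => ?_
  split_ifs <;> ring

omit [Fintype RZ] [DecidableEq RZ] in
/-- The one-sector two-rate failure probability is non-negative for rates in `[0, 1]`.
[cite: DennisEtAl2002, §4.4 eq. (prob_E)] -/
theorem phenomFailureProb_nonneg (H : Matrix RX Q (ZMod 2)) (T : ℕ) (SX : Set (Q → ZMod 2))
    (D : STDecoder RX Q T) {p q : ℝ} (hp0 : 0 ≤ p) (hp1 : p ≤ 1) (hq0 : 0 ≤ q) (hq1 : q ≤ 1) :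
    0 ≤ phenomFailureProb H T SX D p q := by
  unfold phenomFailureProb phenomenologicalWeight
  refine Finset.sum_nonneg fun E _ => indepWeight_nonneg (fun ℓ => ?_) (fun ℓ => ?_) _
  · cases ℓ <;> simpa [phenomRate]
  · cases ℓ <;> simpa [phenomRate]

/-! ### Marginals of the three-rate law on the two failure events -/

open Classical in
/-- **`Z`-sector marginal**: the three-rate mass of the event "`DZ` fails on the `Z`-sector history" is EXACTLY the
two-rate phenomenological failure probability of `DZ` at `(2p/3, q_X)` (the phase-flip part of a depolarizing fault is a
flip of rate `2p/3`, `DepolarizingCSSDecoding.sum_depolarizingProb_zBit_mem`; the `Z`-check measurement faults integrate out).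
[cite: DumerKovalevPryadko2015, eq. (succesful-decoding-depolarizing) (the phase-flip part is decoded on its own)] [cite: DennisEtAl2002, §5.2 (Prob_fail)] -/
theorem sum_depolPhenomWeight_zFails (H : Matrix RX Q (ZMod 2)) (T : ℕ) (SX : Set (Q → ZMod 2))
    (DZ : STDecoder RX Q T) (p qX qZ : ℝ) :
    (∑ E : Q × Fin T → Pauli, ∑ mX : RX × Fin T → ZMod 2, ∑ mZ : RZ × Fin T → ZMod 2,
        if ¬ DZ.Corrects (stSyn H T) (stTrivial SX T) (zHistory E mX) then depolPhenomWeight T p qX qZ E mX mZ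
        else 0) =
      phenomFailureProb H T SX DZ (2 * p / 3) qX := by
  rw [phenomFailureProb_eq_sum_meas]
  -- integrate out `mZ`
  have h1 : ∀ (E : Q × Fin T → Pauli) (mX : RX × Fin T → ZMod 2),
      (∑ mZ : RZ × Fin T → ZMod 2,
        if ¬ DZ.Corrects (stSyn H T) (stTrivial SX T) (zHistory E mX) then depolPhenomWeight T p qX qZ E mX mZ
        else 0) =
      if ¬ DZ.Corrects (stSyn H T) (stTrivial SX T) (zHistory E mX) then
        depolarizingProb p E * bernoulliWeight qX (supp mX) else 0 := by
    intro E mX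
    by_cases hc : DZ.Corrects (stSyn H T) (stTrivial SX T) (zHistory E mX)
    · simp [hc]
    · simp only [hc, not_false_eq_true, if_true, depolPhenomWeight, ← Finset.mul_sum, sum_bernoulliWeight_supp,
        mul_one]
  simp_rw [h1]
  rw [Finset.sum_comm]
  refine Finset.sum_congr rfl fun mX _ => ?_
  -- the `E`-sum over the event `zBit ∘ E ∈ A(mX)` is the `2p/3` Bernoulli mass of `A(mX)`
  have h2 : (∑ E : Q × Fin T → Pauli,
      if ¬ DZ.Corrects (stSyn H T) (stTrivial SX T) (zHistory E mX) then
        depolarizingProb p E * bernoulliWeight qX (supp mX) else 0) =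
      bernoulliWeight qX (supp mX) *
        ∑ E ∈ univ.filter (fun E : Q × Fin T → Pauli => (fun vt => zBit (E vt)) ∈
            univ.filter (fun z : Q × Fin T → ZMod 2 =>
              ¬ DZ.Corrects (stSyn H T) (stTrivial SX T) (Sum.elim z mX))),
          depolarizingProb p E := by
    rw [Finset.mul_sum, Finset.sum_filter]
    refine Finset.sum_congr rfl fun E _ => ?_
    have hiff : ((fun vt => zBit (E vt)) ∈ univ.filter (fun z : Q × Fin T → ZMod 2 =>
        ¬ DZ.Corrects (stSyn H T) (stTrivial SX T) (Sum.elim z mX))) ↔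
        ¬ DZ.Corrects (stSyn H T) (stTrivial SX T) (zHistory E mX) := by
      simp only [mem_filter, mem_univ, true_and, zHistory]
    simp only [hiff]
    split_ifs <;> ring
  rw [h2, sum_depolarizingProb_zBit_mem]

open Classical in
/-- **`X`-sector marginal**: the three-rate mass of "`DX` fails on the `X`-sector history" is the two-rate
phenomenological failure probability of `DX` at `(2p/3, q_Z)` (`DepolarizingCSSDecoding.sum_depolarizingProb_xBit_mem`).
[cite: DumerKovalevPryadko2015, eq. (succesful-decoding-depolarizing) (the bit-flip part is decoded on its own)] [cite: DennisEtAl2002, §5.2 (Prob_fail)] -/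
theorem sum_depolPhenomWeight_xFails (H : Matrix RZ Q (ZMod 2)) (T : ℕ) (SZ : Set (Q → ZMod 2))
    (DX : STDecoder RZ Q T) (p qX qZ : ℝ) :
    (∑ E : Q × Fin T → Pauli, ∑ mX : RX × Fin T → ZMod 2, ∑ mZ : RZ × Fin T → ZMod 2,
        if ¬ DX.Corrects (stSyn H T) (stTrivial SZ T) (xHistory E mZ) then depolPhenomWeight T p qX qZ E mX mZ
        else 0) =
      phenomFailureProb H T SZ DX (2 * p / 3) qZ := by
  rw [phenomFailureProb_eq_sum_meas]
  -- integrate out `mX` (swap the two inner sums first)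
  have h1 : ∀ (E : Q × Fin T → Pauli),
      (∑ mX : RX × Fin T → ZMod 2, ∑ mZ : RZ × Fin T → ZMod 2,
        if ¬ DX.Corrects (stSyn H T) (stTrivial SZ T) (xHistory E mZ) then depolPhenomWeight T p qX qZ E mX mZ
        else 0) =
      ∑ mZ : RZ × Fin T → ZMod 2, if ¬ DX.Corrects (stSyn H T) (stTrivial SZ T) (xHistory E mZ) then
        depolarizingProb p E * bernoulliWeight qZ (supp mZ) else 0 := by
    intro E
    rw [Finset.sum_comm]
    refine Finset.sum_congr rfl fun mZ _ => ?_
    by_cases hc : DX.Corrects (stSyn H T) (stTrivial SZ T) (xHistory E mZ)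
    · simp [hc]
    · have : ∀ mX : RX × Fin T → ZMod 2, depolPhenomWeight T p qX qZ E mX mZ =
          depolarizingProb p E * bernoulliWeight qZ (supp mZ) * bernoulliWeight qX (supp mX) := fun mX => by
        unfold depolPhenomWeight; ring
      simp only [hc, not_false_eq_true, if_true, this, ← Finset.mul_sum, sum_bernoulliWeight_supp, mul_one]
  simp_rw [h1]
  rw [Finset.sum_comm]
  refine Finset.sum_congr rfl fun mZ _ => ?_
  have h2 : (∑ E : Q × Fin T → Pauli,
      if ¬ DX.Corrects (stSyn H T) (stTrivial SZ T) (xHistory E mZ) then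
        depolarizingProb p E * bernoulliWeight qZ (supp mZ) else 0) =
      bernoulliWeight qZ (supp mZ) *
        ∑ E ∈ univ.filter (fun E : Q × Fin T → Pauli => (fun vt => xBit (E vt)) ∈
            univ.filter (fun x : Q × Fin T → ZMod 2 =>
              ¬ DX.Corrects (stSyn H T) (stTrivial SZ T) (Sum.elim x mZ))),
          depolarizingProb p E := by
    rw [Finset.mul_sum, Finset.sum_filter]
    refine Finset.sum_congr rfl fun E _ => ?_
    have hiff : ((fun vt => xBit (E vt)) ∈ univ.filter (fun x : Q × Fin T → ZMod 2 =>
        ¬ DX.Corrects (stSyn H T) (stTrivial SZ T) (Sum.elim x mZ))) ↔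
        ¬ DX.Corrects (stSyn H T) (stTrivial SZ T) (xHistory E mZ) := by
      simp only [mem_filter, mem_univ, true_and, xHistory]
    simp only [hiff]
    split_ifs <;> ring
  rw [h2, sum_depolarizingProb_xBit_mem]

end CSSPhenom

/-! ### Sector-wise space-time decoding of a CSS code under the three-rate law -/

namespace CSSCode

variable {RX RZ Q : Type*} [Fintype Q] [Fintype RX] [Fintype RZ] [DecidableEq Q] [DecidableEq RX] [DecidableEq RZ]

open CSSPhenom

open Classical in
/-- **Failure probability of sector-wise space-time decoding under the phenomenological depolarizing law** (`T`
rounds; qubit depolarizing rate `p`, `X`-check measurement fault rate `qX`, `Z`-check rate `qZ`): `DZ` decodes the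
`X`-check record (phase flips; harmless residuals `rs H^Z`), `DX` the `Z`-check record (bit flips; `rs H^X`); the memory
experiment fails iff one of the two fails. Definition. [cite: DumerKovalevPryadko2015, eq. (succesful-decoding-depolarizing) (both residuals must be trivial)]
[cite: DennisEtAl2002, §4.1 (chunk p0012 L16, paraphrase: separate recovery procedures for the X errors and the Z errors)] -/
def depolPhenomFailureProb (C : CSSCode RX RZ Q) (T : ℕ) (DZ : STDecoder RX Q T) (DX : STDecoder RZ Q T)
    (p qX qZ : ℝ) : ℝ :=
  ∑ E : Q × Fin T → Pauli, ∑ mX : RX × Fin T → ZMod 2, ∑ mZ : RZ × Fin T → ZMod 2,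
    if ¬ (DZ.Corrects (stSyn C.HX T) (stTrivial (C.rowSpZ : Set (Q → ZMod 2)) T) (zHistory E mX) ∧
          DX.Corrects (stSyn C.HZ T) (stTrivial (C.rowSpX : Set (Q → ZMod 2)) T) (xHistory E mZ)) then
      depolPhenomWeight T p qX qZ E mX mZ
    else 0

open Classical in
/-- Non-negativity (rates in `[0, 1]`). [cite: DennisEtAl2002, §4.4 eq. (prob_E)] -/
theorem depolPhenomFailureProb_nonneg (C : CSSCode RX RZ Q) (T : ℕ) (DZ : STDecoder RX Q T)
    (DX : STDecoder RZ Q T) {p qX qZ : ℝ} (hp0 : 0 ≤ p) (hp1 : p ≤ 1) (hqX0 : 0 ≤ qX) (hqX1 : qX ≤ 1)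
    (hqZ0 : 0 ≤ qZ) (hqZ1 : qZ ≤ 1) : 0 ≤ C.depolPhenomFailureProb T DZ DX p qX qZ :=
  Finset.sum_nonneg fun E _ => Finset.sum_nonneg fun mX _ => Finset.sum_nonneg fun mZ _ =>
    ite_nonneg (depolPhenomWeight_nonneg hp0 hp1 hqX0 hqX1 hqZ0 hqZ1 E mX mZ) le_rfl

open Classical in
/-- It is at most `1` (a probability). [cite: DennisEtAl2002, §4.4 eq. (prob_E)] -/
theorem depolPhenomFailureProb_le_one (C : CSSCode RX RZ Q) (T : ℕ) (DZ : STDecoder RX Q T)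
    (DX : STDecoder RZ Q T) {p qX qZ : ℝ} (hp0 : 0 ≤ p) (hp1 : p ≤ 1) (hqX0 : 0 ≤ qX) (hqX1 : qX ≤ 1)
    (hqZ0 : 0 ≤ qZ) (hqZ1 : qZ ≤ 1) : C.depolPhenomFailureProb T DZ DX p qX qZ ≤ 1 := by
  calc C.depolPhenomFailureProb T DZ DX p qX qZ
      ≤ ∑ E : Q × Fin T → Pauli, ∑ mX : RX × Fin T → ZMod 2, ∑ mZ : RZ × Fin T → ZMod 2,
          depolPhenomWeight T p qX qZ E mX mZ := by
        unfold depolPhenomFailureProb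
        refine Finset.sum_le_sum fun E _ => Finset.sum_le_sum fun mX _ => Finset.sum_le_sum fun mZ _ => ?_
        have hw := depolPhenomWeight_nonneg (T := T) hp0 hp1 hqX0 hqX1 hqZ0 hqZ1 E mX mZ
        split_ifs <;> first | exact le_rfl | exact hw
    _ = 1 := sum_depolPhenomWeight (Q := Q) (RX := RX) (RZ := RZ) T p qX qZ

open Classical in
/-- **Lower bound by the `Z` sector**: `P^{Z,ph}(2p/3, q_X) ≤ P_fail` (failure of `DZ` is failure).
[cite: DumerKovalevPryadko2015, eq. (succesful-decoding-depolarizing)] [cite: DennisEtAl2002, §4.1 (chunk p0012 L16, paraphrase: separate recovery for X and Z errors)] -/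
theorem zPhenom_le_depolPhenomFailureProb (C : CSSCode RX RZ Q) (T : ℕ) (DZ : STDecoder RX Q T)
    (DX : STDecoder RZ Q T) {p qX qZ : ℝ} (hp0 : 0 ≤ p) (hp1 : p ≤ 1) (hqX0 : 0 ≤ qX) (hqX1 : qX ≤ 1)
    (hqZ0 : 0 ≤ qZ) (hqZ1 : qZ ≤ 1) :
    phenomFailureProb C.HX T (C.rowSpZ : Set (Q → ZMod 2)) DZ (2 * p / 3) qX ≤
      C.depolPhenomFailureProb T DZ DX p qX qZ := by
  rw [← sum_depolPhenomWeight_zFails (RZ := RZ) C.HX T (C.rowSpZ : Set (Q → ZMod 2)) DZ p qX qZ]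
  unfold depolPhenomFailureProb
  refine Finset.sum_le_sum fun E _ => Finset.sum_le_sum fun mX _ => Finset.sum_le_sum fun mZ _ => ?_
  have hw := depolPhenomWeight_nonneg (T := T) hp0 hp1 hqX0 hqX1 hqZ0 hqZ1 E mX mZ
  by_cases hZ : DZ.Corrects (stSyn C.HX T) (stTrivial (C.rowSpZ : Set (Q → ZMod 2)) T) (zHistory E mX)
  · have h1 : ¬¬ DZ.Corrects (stSyn C.HX T) (stTrivial (C.rowSpZ : Set (Q → ZMod 2)) T) (zHistory E mX) :=
      not_not_intro hZ
    rw [if_neg h1]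
    exact ite_nonneg hw le_rfl
  · rw [if_pos hZ, if_pos (fun h => hZ h.1)]

open Classical in
/-- **Lower bound by the `X` sector**: `P^{X,ph}(2p/3, q_Z) ≤ P_fail`.
[cite: DumerKovalevPryadko2015, eq. (succesful-decoding-depolarizing)] [cite: DennisEtAl2002, §4.1 (chunk p0012 L16, paraphrase: separate recovery for X and Z errors)] -/
theorem xPhenom_le_depolPhenomFailureProb (C : CSSCode RX RZ Q) (T : ℕ) (DZ : STDecoder RX Q T)
    (DX : STDecoder RZ Q T) {p qX qZ : ℝ} (hp0 : 0 ≤ p) (hp1 : p ≤ 1) (hqX0 : 0 ≤ qX) (hqX1 : qX ≤ 1)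
    (hqZ0 : 0 ≤ qZ) (hqZ1 : qZ ≤ 1) :
    phenomFailureProb C.HZ T (C.rowSpX : Set (Q → ZMod 2)) DX (2 * p / 3) qZ ≤
      C.depolPhenomFailureProb T DZ DX p qX qZ := by
  rw [← sum_depolPhenomWeight_xFails (RX := RX) C.HZ T (C.rowSpX : Set (Q → ZMod 2)) DX p qX qZ]
  unfold depolPhenomFailureProb
  refine Finset.sum_le_sum fun E _ => Finset.sum_le_sum fun mX _ => Finset.sum_le_sum fun mZ _ => ?_
  have hw := depolPhenomWeight_nonneg (T := T) hp0 hp1 hqX0 hqX1 hqZ0 hqZ1 E mX mZ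
  by_cases hX : DX.Corrects (stSyn C.HZ T) (stTrivial (C.rowSpX : Set (Q → ZMod 2)) T) (xHistory E mZ)
  · have h1 : ¬¬ DX.Corrects (stSyn C.HZ T) (stTrivial (C.rowSpX : Set (Q → ZMod 2)) T) (xHistory E mZ) :=
      not_not_intro hX
    rw [if_neg h1]
    exact ite_nonneg hw le_rfl
  · rw [if_pos hX, if_pos (fun h => hX h.2)]

open Classical in
/-- **The union bound**: `P_fail ≤ P^{Z,ph}(2p/3, q_X) + P^{X,ph}(2p/3, q_Z)` — the two terms are EXACTLY the one-sector
two-rate phenomenological failure probabilities of the tree (`CSSPhenom.phenomFailureProb`) at qubit rate `2p/3`, so every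
certified two-rate threshold theorem of the two sectors applies.
[cite: DennisEtAl2002, §4.1 (chunk p0012 L16, paraphrase: X/Z correlations cause no trouble since the X errors and the Z errors are recovered by separate procedures)]
[cite: DumerKovalevPryadko2015, eq. (succesful-decoding-depolarizing)] -/
theorem depolPhenomFailureProb_le (C : CSSCode RX RZ Q) (T : ℕ) (DZ : STDecoder RX Q T) (DX : STDecoder RZ Q T)
    {p qX qZ : ℝ} (hp0 : 0 ≤ p) (hp1 : p ≤ 1) (hqX0 : 0 ≤ qX) (hqX1 : qX ≤ 1) (hqZ0 : 0 ≤ qZ) (hqZ1 : qZ ≤ 1) :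
    C.depolPhenomFailureProb T DZ DX p qX qZ ≤
      phenomFailureProb C.HX T (C.rowSpZ : Set (Q → ZMod 2)) DZ (2 * p / 3) qX +
        phenomFailureProb C.HZ T (C.rowSpX : Set (Q → ZMod 2)) DX (2 * p / 3) qZ := by
  rw [← sum_depolPhenomWeight_zFails (RZ := RZ) C.HX T (C.rowSpZ : Set (Q → ZMod 2)) DZ p qX qZ,
    ← sum_depolPhenomWeight_xFails (RX := RX) C.HZ T (C.rowSpX : Set (Q → ZMod 2)) DX p qX qZ]
  unfold depolPhenomFailureProb
  simp only [← Finset.sum_add_distrib]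
  refine Finset.sum_le_sum fun E _ => Finset.sum_le_sum fun mX _ => Finset.sum_le_sum fun mZ _ => ?_
  have hw := depolPhenomWeight_nonneg (T := T) hp0 hp1 hqX0 hqX1 hqZ0 hqZ1 E mX mZ
  by_cases hZ : DZ.Corrects (stSyn C.HX T) (stTrivial (C.rowSpZ : Set (Q → ZMod 2)) T) (zHistory E mX) <;>
    by_cases hX : DX.Corrects (stSyn C.HZ T) (stTrivial (C.rowSpX : Set (Q → ZMod 2)) T) (xHistory E mZ) <;>
    simp only [hZ, hX, and_self, and_true, and_false, not_true_eq_false, not_false_eq_true, if_true, if_false] <;>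
    linarith

end CSSCode

/-! ### The threshold region: family forms -/

namespace CSSCode

open CSSPhenom

variable {RX RZ Q : ℕ → Type*} [∀ i, Fintype (Q i)] [∀ i, Fintype (RX i)] [∀ i, Fintype (RZ i)]
  [∀ i, DecidableEq (Q i)] [∀ i, DecidableEq (RX i)] [∀ i, DecidableEq (RZ i)]

/-- **Below threshold iff both sectors are** (sector-wise space-time decoding, family of CSS codes `C i` monitored for
`T i` rounds, rates in `[0, 1]`): the three-rate failure probability tends to `0` along the family iff BOTH one-sector
two-rate failure probabilities at `(2p/3, q_X)` resp. `(2p/3, q_Z)` do — the region of the three-rate model is the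
intersection of the two (rescaled) sector regions. [cite: DennisEtAl2002, §5.3 eq. (threshold_iso) (the region Prob_fail → 0) with §4.1 (chunk p0012 L16, paraphrase: separate recovery of the two error types)] -/
theorem depolPhenom_belowThreshold_iff (C : ∀ i, CSSCode (RX i) (RZ i) (Q i)) (T : ℕ → ℕ)
    (DZ : ∀ i, STDecoder (RX i) (Q i) (T i)) (DX : ∀ i, STDecoder (RZ i) (Q i) (T i)) {p qX qZ : ℝ}
    (hp0 : 0 ≤ p) (hp1 : p ≤ 1) (hqX0 : 0 ≤ qX) (hqX1 : qX ≤ 1) (hqZ0 : 0 ≤ qZ) (hqZ1 : qZ ≤ 1) :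
    Tendsto (fun i => (C i).depolPhenomFailureProb (T i) (DZ i) (DX i) p qX qZ) atTop (𝓝 0) ↔
      Tendsto (fun i => phenomFailureProb (C i).HX (T i) ((C i).rowSpZ : Set (Q i → ZMod 2)) (DZ i)
          (2 * p / 3) qX) atTop (𝓝 0) ∧
        Tendsto (fun i => phenomFailureProb (C i).HZ (T i) ((C i).rowSpX : Set (Q i → ZMod 2)) (DX i)
          (2 * p / 3) qZ) atTop (𝓝 0) := by
  have hq' : 0 ≤ 2 * p / 3 := by positivity
  have hq'1 : 2 * p / 3 ≤ 1 := by linarith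
  constructor
  · intro h
    exact ⟨squeeze_zero (fun i => phenomFailureProb_nonneg _ _ _ _ hq' hq'1 hqX0 hqX1)
        (fun i => (C i).zPhenom_le_depolPhenomFailureProb (T i) (DZ i) (DX i) hp0 hp1 hqX0 hqX1 hqZ0 hqZ1) h,
      squeeze_zero (fun i => phenomFailureProb_nonneg _ _ _ _ hq' hq'1 hqZ0 hqZ1)
        (fun i => (C i).xPhenom_le_depolPhenomFailureProb (T i) (DZ i) (DX i) hp0 hp1 hqX0 hqX1 hqZ0 hqZ1) h⟩
  · rintro ⟨hZ, hX⟩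
    have hsum := hZ.add hX
    rw [add_zero] at hsum
    exact squeeze_zero
      (fun i => (C i).depolPhenomFailureProb_nonneg (T i) (DZ i) (DX i) hp0 hp1 hqX0 hqX1 hqZ0 hqZ1)
      (fun i => (C i).depolPhenomFailureProb_le (T i) (DZ i) (DX i) hp0 hp1 hqX0 hqX1 hqZ0 hqZ1) hsum

/-- **Certified three-rate box from two certified two-rate boxes**: if every `0 ≤ p', q' < p₀` is below threshold for
the `Z`-sector two-rate family and for the `X`-sector two-rate family, then every `(p, q_X, q_Z)` with `0 ≤ p < (3/2)·p₀`,
`p ≤ 1`, `0 ≤ q_X, q_Z < p₀`, `q_X, q_Z ≤ 1` is below threshold for sector-wise space-time decoding under the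
phenomenological depolarizing law (the `2p/3` is the tree's marginal rate, `DepolarizingCSSDecoding.sum_depolarizingProb_zBit_mem` /
`_xBit_mem`, for the `p/3`-per-Pauli convention). [cite: AliferisGottesmanPreskill2006, §8.2 (arXiv:quant-ph/0504218 chunk p0026 L11)]
[cite: DennisEtAl2002, §5.3 eq. (threshold_iso_num) (the box p, q < .0114 shape)] -/
theorem depolPhenom_belowThreshold_of_box (C : ∀ i, CSSCode (RX i) (RZ i) (Q i)) (T : ℕ → ℕ)
    (DZ : ∀ i, STDecoder (RX i) (Q i) (T i)) (DX : ∀ i, STDecoder (RZ i) (Q i) (T i)) {p₀ : ℝ}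
    (hZ : IsThresholdBoxLowerBound
      (fun i p' q' => phenomFailureProb (C i).HX (T i) ((C i).rowSpZ : Set (Q i → ZMod 2)) (DZ i) p' q') p₀)
    (hX : IsThresholdBoxLowerBound
      (fun i p' q' => phenomFailureProb (C i).HZ (T i) ((C i).rowSpX : Set (Q i → ZMod 2)) (DX i) p' q') p₀)
    {p qX qZ : ℝ} (hp0 : 0 ≤ p) (hp1 : p ≤ 1) (hp : p < 3 / 2 * p₀) (hqX0 : 0 ≤ qX) (hqX1 : qX ≤ 1)
    (hqX : qX < p₀) (hqZ0 : 0 ≤ qZ) (hqZ1 : qZ ≤ 1) (hqZ : qZ < p₀) :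
    Tendsto (fun i => (C i).depolPhenomFailureProb (T i) (DZ i) (DX i) p qX qZ) atTop (𝓝 0) := by
  rw [depolPhenom_belowThreshold_iff C T DZ DX hp0 hp1 hqX0 hqX1 hqZ0 hqZ1]
  have hp' : 2 * p / 3 < p₀ := by linarith
  have hp'0 : 0 ≤ 2 * p / 3 := by positivity
  exact ⟨hZ _ _ hp'0 hqX0 hp' hqX, hX _ _ hp'0 hqZ0 hp' hqZ⟩

/-- **Different boxes for the two sectors** (`p₀^Z` for the `Z`-sector two-rate family, `p₀^X` for the `X`-sector one):
below threshold whenever `0 ≤ p < (3/2)·min(p₀^Z, p₀^X)`, `q_X < p₀^Z`, `q_Z < p₀^X` (rates in `[0, 1]`).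
[cite: DennisEtAl2002, §5.3 eq. (threshold_iso) with §4.1 (chunk p0012 L16, paraphrase: separate recovery of the two error types)] -/
theorem depolPhenom_belowThreshold_of_boxes (C : ∀ i, CSSCode (RX i) (RZ i) (Q i)) (T : ℕ → ℕ)
    (DZ : ∀ i, STDecoder (RX i) (Q i) (T i)) (DX : ∀ i, STDecoder (RZ i) (Q i) (T i)) {pZ pX : ℝ}
    (hZ : IsThresholdBoxLowerBound
      (fun i p' q' => phenomFailureProb (C i).HX (T i) ((C i).rowSpZ : Set (Q i → ZMod 2)) (DZ i) p' q') pZ)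
    (hX : IsThresholdBoxLowerBound
      (fun i p' q' => phenomFailureProb (C i).HZ (T i) ((C i).rowSpX : Set (Q i → ZMod 2)) (DX i) p' q') pX)
    {p qX qZ : ℝ} (hp0 : 0 ≤ p) (hp1 : p ≤ 1) (hp : p < 3 / 2 * min pZ pX) (hqX0 : 0 ≤ qX) (hqX1 : qX ≤ 1)
    (hqX : qX < pZ) (hqZ0 : 0 ≤ qZ) (hqZ1 : qZ ≤ 1) (hqZ : qZ < pX) :
    Tendsto (fun i => (C i).depolPhenomFailureProb (T i) (DZ i) (DX i) p qX qZ) atTop (𝓝 0) := by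
  rw [depolPhenom_belowThreshold_iff C T DZ DX hp0 hp1 hqX0 hqX1 hqZ0 hqZ1]
  have hmZ : min pZ pX ≤ pZ := min_le_left _ _
  have hmX : min pZ pX ≤ pX := min_le_right _ _
  have hpZ : 2 * p / 3 < pZ := by linarith
  have hpX : 2 * p / 3 < pX := by linarith
  have hp'0 : 0 ≤ 2 * p / 3 := by positivity
  exact ⟨hZ _ _ hp'0 hqX0 hpZ hqX, hX _ _ hp'0 hqZ0 hpX hqZ⟩

end CSSCode

end Literature.InformationTheory.QuantumCodes

end
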